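import Summits.Parity.GeneralizedHardyLittlewood.Theorems.FordMaynardSieveConst01651SieveConst01651PairingOne
import Summits.Parity.GeneralizedHardyLittlewood.Theorems.FordMaynardSieveConst01651SieveConst01651PairingThree
import Summits.Parity.GeneralizedHardyLittlewood.Theorems.FordMaynardSieveConst01651SieveConst01651BuchstabCertEval
import HarnessLib

/-!
# Route `FordMaynardSieveConst01651`, target `SieveConst01651` (stmt-Parity-19185), stub `stub_certValuePos` (R2):
# ASSEMBLY — the stub follows from the soundness of the `g₂` rectangle sums alone

Def-free helper file.  Everything of the certificate for `0 < V(ν₀, coneCert)` is in the tree except the soundness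
of the two rectangle sums `certP`, `certN` of `…BuchstabCert` against the `r = 2` pairing
`I₂ = ∫_{(0,1/2]} S⁰_2(t) Φ₆(1−t) dt`.  This file records the final implication

  `stub_certValuePos_of_pairingTwo : (certP − certN)/D ≤ I₂ → 0 < sieveBoundG1 (1651/10000) coneCert`

from the cut form (`…BuchstabCuts.sieveBoundG1_coneCert_eq_cut`), `Φ₆(1) ≥ (D + certPsiOne)/D`
(`…BuchstabTableSound.phiSix_one_bounds`), `∫_{(ν₀,1/2]} Φ₆(1−t)/t ≤ certU1/D` (`…PairingOne`), `I₃ ≥ 0`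
(`…PairingThree`) and the kernel fact `certU1 + certN < D + certPsiOne + certP` (`…BuchstabCertEval.cert_ineq`).
What remains for the registered stub is the ONE inequality `(certP − certN)/D ≤ I₂` (Fubini + shear to the
`(y₀, y₁)`-plane, null faces, `coneCert_two_eq_lookup` on the open cells, the inner/outer grid rectangles
`entryRects`, the tangent/chord brackets of `∫∫ du dv/(uv)` and the block-table lookups `phiLoRange/phiHiRange`).

References: [FordMaynard2024PrimeSieves] arXiv:2407.14368, Theorem 7.3 (a), §8.2.
-/

noncomputable section

open MeasureTheory Set Finset
open scoped Classical
open Literature.NumberTheory.Sieve Literature.NumberTheory.Sieve.FordMaynard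
open Literature.Analysis.Convolution

namespace Summit.Parity.GeneralizedHardyLittlewood.FordMaynardSieveConst01651SieveConst01651

/-- **`stub_certValuePos` from the `r = 2` rectangle soundness.**  If the certified rectangle sums bound the
`g₂` pairing from below, `(certP − certN)/D ≤ ∫_{(0,1/2]} S⁰_2(t) Φ₆(1−t) dt`, then `0 < V(ν₀, coneCert)`.
[cite: FordMaynard2024PrimeSieves, Theorem 7.3 (a), §8.2] -/
theorem stub_certValuePos_of_pairingTwo
    (h2 : ((certP : ℕ) : ℝ) / tabD - ((certN : ℕ) : ℝ) / tabD ≤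
      ∫ t in Set.Ioc 0 (1 / 2), sliceIntegral 2 t
          (fun v => if (∀ i, (1651 / 10000 : ℝ) < v i) ∧ Monotone v then coneCert 2 v / ∏ i, v i else 0) *
        ∑ m ∈ Finset.Icc 1 6, (1 / (m.factorial : ℝ)) *
          cpow (fun t : ℝ => if (1651 / 10000 : ℝ) < t then 1 / t else 0) m (1 - t)) :
    0 < sieveBoundG1 (1651 / 10000) coneCert := by
  have hD : (0 : ℝ) < tabD := by norm_num [tabD]
  rw [sieveBoundG1_coneCert_eq_cut, ← phiSix_one_eq]
  have hone := phiSix_one_bounds.1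
  have h1 := pairing_one_le_certU1
  have h3 := pairing_three_nonneg
  have hc : ((certU1 : ℕ) : ℝ) + certN < (tabD : ℝ) + certPsiOne + certP := by exact_mod_cast cert_ineq
  have hc' : ((certU1 : ℕ) : ℝ) / tabD + ((certN : ℕ) : ℝ) / tabD <
      ((tabD + certPsiOne : ℕ) : ℝ) / tabD + ((certP : ℕ) : ℝ) / tabD := by
    rw [← add_div, ← add_div, div_lt_div_iff_of_pos_right hD]
    push_cast
    linarith
  have hone' : (((tabD + certPsiOne : ℕ) : ℝ)) / tabD ≤ ∑ m ∈ Finset.Icc 1 6, (1 / (m.factorial : ℝ)) *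
      cpow (fun t : ℝ => if (1651 / 10000 : ℝ) < t then 1 / t else 0) m 1 := by
    unfold certPsiOne
    exact hone
  linarith

end Summit.Parity.GeneralizedHardyLittlewood.FordMaynardSieveConst01651SieveConst01651

end
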